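import Literature.MathematicalPhysics.QuantumFieldTheory.UnevenAxialBlocking

/-!
# Parity covariance of the uneven axial blocking (helper for `LuscherReduction.TwistedTraceScaling`)

Helper file (count-neutral, `--supports stmt-QuantumFields-20203`): crux idea `parity-valley-regularity`
(ideator 2), CHECK ITEM «exact parity of every blocked Wilson theory of the E1 tower», and the disprover's
pre-vet `Cruxes/TwistedTraceScaling/Disproof.lean` rev 7 §J (V7) («the parity card's CHECK ITEM also holds for
the tree's uneven blocking — ONE odd block, reflection axis through its middle … a pure combinatorial guard»).
This file makes the guard a THEOREM for the tree's blocking map `unevenAxialLink b N T` (any dimension `d`,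
any group `G`, regime `b (T-1) ≤ N` = the regime of gauge covariance / tiling in `UnevenAxialBlocking`).

* `siteReflect L ν a x` — reflection of the torus of side `L` in the axis direction `ν`: `x_ν ↦ a − x_ν`;
* `linkReflect L ν a U` — the induced PARITY of a gauge field: links in direction `ν` are reversed,
  `(πU)(x, ν) = U(σx − e_ν, ν)⁻¹`, links in `μ ≠ ν` are carried along, `(πU)(x, μ) = U(σx, μ)`
  (for `ν = 0`, `a = 1` it IS the tree's Osterwalder–Seiler `GaugeConfig.timeReflect`:
  `linkReflect_zero_one_eq_timeReflect`); `linkReflect_linkReflect` — an involution;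
* `transport_linkReflect_of_ne` / `transport_linkReflect_self` — straight transporters of `πU`;
* ★ `unevenAxialLink_linkReflect` — **the uneven axial blocking intertwines the parities**: for
  `b (T-1) ≤ N`, `unevenAxialLink b N T (linkReflect N ν (b(T-1)) U) = linkReflect T ν (T-1) (unevenAxialLink b N T U)`
  (fine axis `x_ν ↦ b(T−1) − x_ν` maps the block corners `{0, b, …, b(T−1)}` to themselves and the odd last arc
  onto itself; block axis `y_ν ↦ T − 1 − y_ν`).
The Wilson-action and blocked-density consequences are in `ParityBlockedDensity`.

HONEST FRAMING: combinatorial bookkeeping for a module of a stub of a child of a CONDITIONAL reduction route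
(femto rung R2b1); nothing of the RG content (W-REP/W-CMP/W-FLOW), not a gap, not Clay.
-/
noncomputable section

open Literature.MathematicalPhysics.QuantumLattice
open Literature.MathematicalPhysics.QuantumFieldTheory

namespace Summit.QuantumFields.YangMills.Theorems.TwistedTraceScaling.ParityBlocking

variable {d : ℕ} {G : Type*}

/-! ### Axis reflections of sites and the induced parity of gauge fields -/

/-- Reflection of the discrete torus of side `L` in the axis direction `ν` about `a/2`:
`x_ν ↦ a − x_ν`, the other coordinates unchanged. -/
def siteReflect (L : ℕ) (ν : Fin d) (a : ZMod L) (x : Site d L) : Site d L :=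
  Function.update x ν (a - x ν)

/-- **Parity of a gauge field** under the axis reflection `siteReflect L ν a`: a link in direction
`ν` from `x` to `x + e_ν` is mapped to the link from `σx − e_ν` to `σx`, traversed BACKWARDS, so its
variable is inverted; links in directions `μ ≠ ν` are carried along. -/
def linkReflect [Group G] (L : ℕ) (ν : Fin d) (a : ZMod L) (U : GaugeConfig d L G) :
    GaugeConfig d L G :=
  fun e => if e.2 = ν then (U (siteReflect L ν (a - 1) e.1, ν))⁻¹ else U (siteReflect L ν a e.1, e.2)

variable {L : ℕ} (ν : Fin d) (a : ZMod L)

/-- The reflected coordinate. -/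
@[simp] theorem siteReflect_apply_self (x : Site d L) : siteReflect L ν a x ν = a - x ν := by
  simp [siteReflect]

/-- The other coordinates are unchanged. -/
theorem siteReflect_apply_of_ne {i : Fin d} (hi : i ≠ ν) (x : Site d L) :
    siteReflect L ν a x i = x i := by
  simp [siteReflect, hi]

/-- The reflection is an involution. -/
theorem siteReflect_siteReflect (x : Site d L) : siteReflect L ν a (siteReflect L ν a x) = x := by
  funext i
  by_cases hi : i = ν
  · subst hi; simp [siteReflect]
  · simp [siteReflect, hi]

/-- Shifting in a direction `μ ≠ ν` commutes with the reflection in direction `ν`. -/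
theorem siteReflect_shift_of_ne {μ : Fin d} (hμ : μ ≠ ν) (x : Site d L) :
    siteReflect L ν a (x.shift μ) = (siteReflect L ν a x).shift μ := by
  funext i
  simp only [Site.shift, siteReflect, Pi.add_apply]
  by_cases hi : i = ν
  · subst hi
    simp [Ne.symm hμ]
  · simp [hi]

/-- Shifting in direction `ν` LOWERS the reflected coordinate by one. -/
theorem siteReflect_shift_self (x : Site d L) :
    siteReflect L ν a (x.shift ν) = siteReflect L ν (a - 1) x := by
  funext i
  simp only [Site.shift, siteReflect, Pi.add_apply]
  by_cases hi : i = ν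
  · subst hi
    simp; ring
  · simp [hi]

/-- Links in the reflected direction: reversed and inverted. -/
theorem linkReflect_apply_self [Group G] (U : GaugeConfig d L G) (x : Site d L) :
    linkReflect L ν a U (x, ν) = (U (siteReflect L ν (a - 1) x, ν))⁻¹ := by
  simp [linkReflect]

/-- Links in the other directions: carried along. -/
theorem linkReflect_apply_of_ne [Group G] (U : GaugeConfig d L G) (x : Site d L) {μ : Fin d}
    (hμ : μ ≠ ν) : linkReflect L ν a U (x, μ) = U (siteReflect L ν a x, μ) := by
  simp [linkReflect, hμ]

/-- **Parity is an involution** on gauge fields. -/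
theorem linkReflect_linkReflect [Group G] (U : GaugeConfig d L G) :
    linkReflect L ν a (linkReflect L ν a U) = U := by
  funext e
  obtain ⟨x, μ⟩ := e
  by_cases hμ : μ = ν
  · subst hμ
    rw [linkReflect_apply_self, linkReflect_apply_self, inv_inv]
    congr 1
    refine Prod.ext ?_ rfl
    funext i
    by_cases hi : i = μ
    · subst hi; simp [siteReflect]
    · simp [siteReflect, hi]
  · rw [linkReflect_apply_of_ne _ _ _ _ hμ, linkReflect_apply_of_ne _ _ _ _ hμ,
      siteReflect_siteReflect]

/-! ### Straight transporters of the reflected field -/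

/-- A straight path in a direction `μ ≠ ν` is carried along by the reflection. -/
theorem transport_linkReflect_of_ne [Group G] (U : GaugeConfig d L G) {μ : Fin d} (hμ : μ ≠ ν)
    (n : ℕ) (c : Site d L) :
    transport (linkReflect L ν a U) c (List.replicate n μ) =
      transport U (siteReflect L ν a c) (List.replicate n μ) := by
  induction n generalizing c with
  | zero => simp
  | succ n ih =>
    rw [List.replicate_succ, transport_cons, transport_cons, ih, linkReflect_apply_of_ne _ _ _ _ hμ,
      siteReflect_shift_of_ne _ _ hμ]

/-- The endpoint of a straight path of `n` steps in direction `μ`. -/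
theorem pathEnd_replicate (c : Site d L) (μ : Fin d) (n : ℕ) :
    pathEnd c (List.replicate n μ) = c + n • (Pi.single μ (1 : ZMod L) : Site d L) := by
  rw [pathEnd_eq_add, List.map_replicate, List.sum_replicate]

/-- A straight path in the reflected direction `ν` is mapped to the reflected path traversed
backwards: the transporter of the reflected field from `c` of `n` steps is the INVERSE of the
transporter of the original field from `σ_{a-n} c` (the reflected endpoint) of `n` steps. -/
theorem transport_linkReflect_self [Group G] (U : GaugeConfig d L G) (n : ℕ) (c : Site d L) :
    transport (linkReflect L ν a U) c (List.replicate n ν) =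
      (transport U (siteReflect L ν (a - n) c) (List.replicate n ν))⁻¹ := by
  induction n generalizing c with
  | zero => simp
  | succ n ih =>
    -- split the LAST link off the original path
    have hsplit : transport U (siteReflect L ν (a - (n + 1 : ℕ)) c) (List.replicate (n + 1) ν) =
        transport U (siteReflect L ν (a - (n + 1 : ℕ)) c) (List.replicate n ν) *
          U (siteReflect L ν (a - 1) c, ν) := by
      rw [List.replicate_succ', transport_append, transport_cons, transport_nil, mul_one,
        pathEnd_replicate]
      congr 2
      refine Prod.ext ?_ rfl
      funext i
      simp only [Pi.add_apply, Pi.smul_apply, siteReflect]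
      by_cases hi : i = ν
      · subst hi
        simp only [Function.update_self, Pi.single_eq_same, nsmul_eq_mul, mul_one]
        push_cast
        ring
      · simp [hi]
    -- the start of the reflected path
    have hstart : siteReflect L ν (a - n - 1) c = siteReflect L ν (a - (n + 1 : ℕ)) c := by
      funext i
      by_cases hi : i = ν
      · subst hi; simp [siteReflect]; ring
      · simp [siteReflect, hi]
    rw [hsplit, mul_inv_rev, List.replicate_succ, transport_cons, ih, linkReflect_apply_self,
      siteReflect_shift_self, hstart]

/-! ### Corner and length bookkeeping of the uneven blocking under the reflections -/

section Corner

variable {b N T : ℕ}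

/-- The value of the reflected block coordinate: no wrap-around, `(T-1-y_ν)`. -/
theorem val_sub_eq [NeZero T] (y : ZMod T) :
    (((T - 1 : ℕ) : ZMod T) - y).val = T - 1 - y.val := by
  have hy : y.val ≤ T - 1 := Nat.le_sub_one_of_lt (ZMod.val_lt y)
  conv_lhs => rw [← ZMod.natCast_zmod_val y, ← Nat.cast_sub hy]
  rw [ZMod.val_natCast]
  exact Nat.mod_eq_of_lt (lt_of_le_of_lt (Nat.sub_le _ _) (Nat.sub_lt (NeZero.pos T) one_pos))

/-- Transverse directions: the reflected corner is the corner of the reflected block site. -/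
theorem siteReflect_unevenCorner [NeZero T] (y : Site d T) :
    siteReflect N ν ((b * (T - 1) : ℕ) : ZMod N) (unevenCorner b N T y) =
      unevenCorner b N T (siteReflect T ν ((T - 1 : ℕ) : ZMod T) y) := by
  funext i
  by_cases hi : i = ν
  · subst hi
    rw [siteReflect_apply_self, unevenCorner_apply, unevenCorner_apply, siteReflect_apply_self,
      val_sub_eq]
    have hv : (y i).val ≤ T - 1 := Nat.le_sub_one_of_lt (ZMod.val_lt _)
    have hsplit : b * (T - 1) = b * (T - 1 - (y i).val) + b * (y i).val := by
      rw [← Nat.mul_add, Nat.sub_add_cancel hv]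
    rw [hsplit]; push_cast; ring
  · rw [siteReflect_apply_of_ne _ _ hi, unevenCorner_apply, unevenCorner_apply,
      siteReflect_apply_of_ne _ _ hi]

/-- Transverse directions: the path length only depends on the coordinate in the path's direction. -/
theorem unevenLen_siteReflect_of_ne (y : Site d T) {μ : Fin d} (hμ : μ ≠ ν) (a : ZMod T) :
    unevenLen b N T (siteReflect T ν a y) μ = unevenLen b N T y μ := by
  simp [unevenLen, siteReflect_apply_of_ne _ _ hμ]

/-- Longitudinal direction, block level: the start site of the reversed block link. -/
theorem blockStart_eq [NeZero T] (y : Site d T) :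
    siteReflect T ν (((T - 1 : ℕ) : ZMod T) - 1) y =
      Function.update y ν (((T - 1 : ℕ) : ZMod T) - 1 - y ν) := rfl

/-- Longitudinal direction: the reversed image of the LAST block is the last block, with the same
length, and the reflected path start is its corner (`b(T-1) − b(T-1) − (N − b(T-1)) ≡ b(T-1)`
modulo `N`). -/
theorem corner_last [NeZero T] (hN : b * (T - 1) ≤ N) (y : Site d T) (h : (y ν).val + 1 = T) :
    ((siteReflect T ν (((T - 1 : ℕ) : ZMod T) - 1) y) ν).val + 1 = T ∧
    siteReflect N ν (((b * (T - 1) : ℕ) : ZMod N) - (unevenLen b N T y ν : ℕ)) (unevenCorner b N T y) =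
      unevenCorner b N T (siteReflect T ν (((T - 1 : ℕ) : ZMod T) - 1) y) := by
  have hyv : (y ν).val = T - 1 := by omega
  have hy : y ν = ((T - 1 : ℕ) : ZMod T) := by rw [← hyv, ZMod.natCast_zmod_val]
  have hrefl : (siteReflect T ν (((T - 1 : ℕ) : ZMod T) - 1) y) ν = ((T - 1 : ℕ) : ZMod T) := by
    rw [siteReflect_apply_self, hy, sub_sub_cancel_left, neg_eq_iff_add_eq_zero]
    have : ((T - 1 : ℕ) : ZMod T) + 1 = ((T - 1 + 1 : ℕ) : ZMod T) := by push_cast; ring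
    rw [add_comm, this, Nat.sub_add_cancel (NeZero.pos T), ZMod.natCast_self]
  have hval : (((T - 1 : ℕ) : ZMod T)).val = T - 1 := by
    rw [ZMod.val_natCast, Nat.mod_eq_of_lt (Nat.sub_lt (NeZero.pos T) one_pos)]
  refine ⟨by rw [hrefl, hval]; omega, ?_⟩
  funext i
  by_cases hi : i = ν
  · subst hi
    rw [siteReflect_apply_self, unevenCorner_apply, unevenCorner_apply, hrefl, hval, hyv,
      unevenLen_of_eq h, sub_sub_cancel_left, Nat.cast_sub hN, neg_sub, sub_eq_self,
      ZMod.natCast_self]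
  · rw [siteReflect_apply_of_ne _ _ hi, unevenCorner_apply, unevenCorner_apply,
      siteReflect_apply_of_ne _ _ hi]

/-- Longitudinal direction: the reversed image of the block `y_ν = k ≤ T-2` is the block
`T - 2 - k` (not the last one), with the same length `b`, and the reflected path start is its corner
(`b(T-1) − bk − b = b(T-2-k)`). -/
theorem corner_notLast [NeZero T] (y : Site d T) (h : (y ν).val + 1 ≠ T) :
    ((siteReflect T ν (((T - 1 : ℕ) : ZMod T) - 1) y) ν).val + 1 ≠ T ∧
    siteReflect N ν (((b * (T - 1) : ℕ) : ZMod N) - (unevenLen b N T y ν : ℕ)) (unevenCorner b N T y) =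
      unevenCorner b N T (siteReflect T ν (((T - 1 : ℕ) : ZMod T) - 1) y) := by
  have hlt : (y ν).val + 1 < T := lt_of_le_of_ne (ZMod.val_lt (y ν)) h
  set k := (y ν).val with hk
  have hy : y ν = (k : ZMod T) := (ZMod.natCast_zmod_val (y ν)).symm
  have hk2 : k + 2 ≤ T := hlt
  have hrefl : (siteReflect T ν (((T - 1 : ℕ) : ZMod T) - 1) y) ν = ((T - 2 - k : ℕ) : ZMod T) := by
    rw [siteReflect_apply_self, hy]
    have : ((T - 1 : ℕ) : ZMod T) = ((T - 2 - k : ℕ) : ZMod T) + 1 + (k : ZMod T) := by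
      have h' : T - 1 = (T - 2 - k) + 1 + k := by omega
      rw [h']; push_cast; ring
    rw [this]; ring
  have hval : (((T - 2 - k : ℕ) : ZMod T)).val = T - 2 - k := by
    rw [ZMod.val_natCast, Nat.mod_eq_of_lt (by omega)]
  refine ⟨by rw [hrefl, hval]; omega, ?_⟩
  funext i
  by_cases hi : i = ν
  · subst hi
    rw [siteReflect_apply_self, unevenCorner_apply, unevenCorner_apply, hrefl, hval, ← hk,
      unevenLen_of_ne h]
    have h' : b * (T - 1) = b * (T - 2 - k) + b + b * k := by
      have : T - 1 = (T - 2 - k) + 1 + k := by omega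
      rw [this]; ring
    rw [h']; push_cast; ring
  · rw [siteReflect_apply_of_ne _ _ hi, unevenCorner_apply, unevenCorner_apply,
      siteReflect_apply_of_ne _ _ hi]

end Corner

/-! ### The intertwining theorem -/

/-- ★ **Parity covariance of the uneven axial blocking.**  For `b (T-1) ≤ N` the uneven axial
blocking `Ū = unevenAxialLink b N T` of a torus of side `N` to the block torus of side `T`
INTERTWINES the parity of the fine torus in the axis direction `ν` about `b(T-1)/2` (which maps the
block corners `0, b, …, b(T-1)` to themselves and the odd last arc `[b(T-1), N]` onto itself) with
the parity of the block torus about `(T-1)/2`:  `Ū(π_N U) = π_T(Ū U)` — exactly, for every gauge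
field, in every dimension and for every group.  (This is the dihedral axis through the middle of the
ONE odd block of the side-word `b^{T-1}·(N − b(T−1))`; the even blocking `N = b·T` is included.) -/
theorem unevenAxialLink_linkReflect [Group G] {b N T : ℕ} [NeZero T] (hN : b * (T - 1) ≤ N)
    (ν : Fin d) (U : GaugeConfig d N G) :
    unevenAxialLink b N T (linkReflect N ν ((b * (T - 1) : ℕ) : ZMod N) U) =
      linkReflect T ν ((T - 1 : ℕ) : ZMod T) (unevenAxialLink b N T U) := by
  funext e
  obtain ⟨y, μ⟩ := e
  simp only [unevenAxialLink_apply]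
  by_cases hμ : μ = ν
  · subst hμ
    rw [linkReflect_apply_self, unevenAxialLink_apply, transport_linkReflect_self]
    -- the reflected start is the corner of the image block, whose length is the same
    by_cases h : (y μ).val + 1 = T
    · obtain ⟨hlast, hcorner⟩ := corner_last (ν := μ) hN y h
      rw [hcorner, unevenLen_of_eq h, unevenLen_of_eq hlast]
    · obtain ⟨hnot, hcorner⟩ := corner_notLast (b := b) (N := N) (ν := μ) y h
      rw [hcorner, unevenLen_of_ne h, unevenLen_of_ne hnot]
  · rw [linkReflect_apply_of_ne _ _ _ _ hμ, unevenAxialLink_apply,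
      transport_linkReflect_of_ne _ _ _ hμ, siteReflect_unevenCorner,
      unevenLen_siteReflect_of_ne _ _ hμ]

/-- The same statement read as an EQUIVARIANCE: blocking the reflected field and reflecting back
gives the blocked field. -/
theorem linkReflect_unevenAxialLink_linkReflect [Group G] {b N T : ℕ} [NeZero T]
    (hN : b * (T - 1) ≤ N) (ν : Fin d) (U : GaugeConfig d N G) :
    linkReflect T ν ((T - 1 : ℕ) : ZMod T)
        (unevenAxialLink b N T (linkReflect N ν ((b * (T - 1) : ℕ) : ZMod N) U)) =
      unevenAxialLink b N T U := by
  rw [unevenAxialLink_linkReflect hN, linkReflect_linkReflect]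

/-- Pull-back form: a function of the block field that is EVEN under the block parity pulls back
along the blocking to a function of the fine field that is even under the fine parity — the shape in
which «evenness for free» is consumed (blocked densities / effective actions as functions of the
block field). -/
theorem comp_unevenAxialLink_even [Group G] {b N T : ℕ} [NeZero T] (hN : b * (T - 1) ≤ N)
    (ν : Fin d) {α : Type*} {F : GaugeConfig d T G → α}
    (hF : ∀ V, F (linkReflect T ν ((T - 1 : ℕ) : ZMod T) V) = F V) (U : GaugeConfig d N G) :
    F (unevenAxialLink b N T (linkReflect N ν ((b * (T - 1) : ℕ) : ZMod N) U)) =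
      F (unevenAxialLink b N T U) := by
  rw [unevenAxialLink_linkReflect hN, hF]


/-! ### Consistency with the tree's Osterwalder–Seiler reflection -/

/-- In the time direction `ν = 0` about `a = 1` the parity IS the tree's Osterwalder–Seiler
reflection `GaugeConfig.timeReflect` (hyperplane between the slices `0 | 1`), whose plaquette
covariance is `plaqRe_timeReflect` (file `ConstructiveQFTWave0Proofs`). -/
theorem linkReflect_zero_one_eq_timeReflect [Group G] [NeZero d] (U : GaugeConfig d L G) :
    linkReflect L 0 1 U = U.timeReflect := by
  funext e
  obtain ⟨x, μ⟩ := e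
  have hσ : ∀ y : Site d L, y.timeReflect = siteReflect L 0 1 y := fun _ => rfl
  by_cases hμ : μ = 0
  · subst hμ
    simp only [linkReflect, GaugeConfig.timeReflect, if_true, hσ, siteReflect_shift_self]
  · simp only [linkReflect, GaugeConfig.timeReflect, hμ, if_false, hσ]

end Summit.QuantumFields.YangMills.Theorems.TwistedTraceScaling.ParityBlocking
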